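import Summits.BirchSwinnertonDyer.BirchSwinnertonDyer.Theorems.SemiOrdinaryEisensteinDescentWildKolyvaginUpperAtThreeOfMinftyGe
import Summits.BirchSwinnertonDyer.BirchSwinnertonDyer.Theorems.TameQuarticManinParityTprimeHeegnerUpperOfManinUnitIrreducibleRows
import Summits.BirchSwinnertonDyer.BirchSwinnertonDyer.Theorems.CumulativeHeegnerLeopoldtCumulativeHeegnerInclusionAtThreeCornutVatsalFamily
import Literature.NumberTheory.EllipticCurves.BSDHeegnerPointsSignProofs
import Literature.NumberTheory.EllipticCurves.AnalyticRankModularityProofs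
import HarnessLib

/-!
CONDITIONAL door: Σ on the 3-adic-tower-onto rows ⟸ T1⁺ via SOED `pDiv_of_minftyGe`; closes nothing. (Label prescribed by director-bsd
(858)(a), 2026-08-31T16:45:48Z: def-free, BY NAME from the cell's EXISTING filed conjecture item T1⁺ `AdditiveThree.RKC3Divisibility` —
no new conjecture declaration, no new item.)

# Crux X₄ `TprimeHeegnerUpperOfManinUnit` (stmt-BirchSwinnertonDyer-23738; TQMP r4 / TQS r303), line `rows_of_manin_unit` v2
# (08412075024a), research stub Σ `stub_sigmaIrreducibleOptimalRows`: Σ ON THE 3-ADIC-TOWER ROWS IS AN INSTANCE OF THE CELL'S FILED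
# CONJECTURE ITEM T1⁺ `AdditiveThree.RKC3Divisibility` (refined Kolyvagin conjecture at an additive `3`, divisibility half) —
# a CONDITIONAL bridge keying the research residual Σ⁺ to an existing `@[conjecture]` declaration, BY NAME

HONEST FRAMING. Theorems only; helper file (`--supports stmt-BirchSwinnertonDyer-23738 --as helper`, leafhand
`leafhand-bsd-tamequarticmaninpa-6` g0, 2026-08-31); no definition, no named fact, no `sorry`; CONDITIONAL on the displayed
hypotheses — in particular on the OPEN conjecture item T1⁺ `Summit.BirchSwinnertonDyer.Rank1Residual.AdditiveThree.RKC3Divisibility`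
(`@[conjecture] def`, file `Summits/BirchSwinnertonDyer/Rank1Residual/Additive/WildThreeRefinedKolyvagin.lean`, cell b2b-bsdres O5/O6) taken
as a hypothesis (`proof.conditional`); nothing booked, no stub closed BY NAME, no item closed, BSD proved for no curve.

WHY. After the carrier-blind reading (p827050 … p828099) the residual of Σ is the increment Σ⁺ on the rows with ≥ 2 Tamagawa-`3`
carriers (p827819), and the sibling file `…SigmaMethodBarrier` certifies that Jetchev's §6 inputs cannot pay it. The statement that DOES
pay it is the refined Kolyvagin conjecture `M_∞ ≥ ord₃ ∏_q c_q` at the additive prime `3` — which the tree already carries, in CLASS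
currency, as the typed conjecture item T1⁺ `RKC3Divisibility` (scope: `9 ∣ N_E`, `ρ_{E,3^∞}` onto = `TowerSurjThree`, `K` Heegner with
`d_K ≠ −3, −4`, `ord_{s=1} L(E/K,s) = 1`, a parametrisation datum with `3 ∤ c`). This file proves, in the kernel, that Σ's statement
VERBATIM — restricted to the rows where the `3`-adic tower is onto (one extra binder `TowerSurjThree W`) — follows from T1⁺ and ONE
print input of the skeleton (`exists_isNewformOf`, BCDT: entire continuation, used to read `ord_{s=1} L(E/K,s) = r_an(E) + r_an(E^{(d_K)})
= 1 + 0`): §1 `sigma_towerRows_of_rkc3Divisibility`; §2 `sigmaIncrementTwoSplit_towerRows_of_rkc3Divisibility` = the same for the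
pen's STAGED v3 residual stub Σ⁺₂ `stub_sigmaIncrementTwoSplit` (b1b621d03ef2796d) verbatim + the tower binder. The class ⟹ point
currency conversion is SOED's landed `WildKolyvaginUpperAtThreeOfMinftyGe.pDiv_of_minftyGe` (McCallum Cor. 4.5 at the datum; it needs
`ρ̄_{E,3}` onto, which the tower binder supplies at `n = 1`); `9 ∣ N_E` is `Addv W 3` (`sq_dvd_conductorNorm_of_addv_three`); `d_K ≠ −3`
is the Heegner hypothesis at `3 ∣ N_E` (`SatisfiesHeegnerHypothesis.coprime_discr`); `d_K ≠ −4`, `d_K < −4` from `d_K` odd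
(`discr_lt_neg_four_of_odd`); the orientation `4N ∣ β² − d_K` is the datum's own `KolyvaginHeegnerData.dvd_sq_sub`.
DISCLOSED LINT: one `lint.theses-cone` warning — the class ⟹ point conversion `pDiv_of_minftyGe` lives in a module importing the SOED route
file (its own ingredients `KolyCert.*` sit in the KolyvaginRoadThree cone); no cone-free copy exists and restating it would be a duplicate.
READING FOR THE PLANNER (not a registry act): on the tower-onto irreducible rows, Σ (hence Σ⁺₂) is T1⁺ BY NAME + print; T1⁺ is by
Kolyvagin's structure theorem equivalent pair by pair to the `3`-part of BSD for `E/K` in Gross–Zagier form (docstring of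
`RefinedKolyvaginAdditiveThree`), so the residual of the line on those rows is a CONJECTURE-KEYED input, not a hand-sized lemma; the rows
with `ρ̄_{E,3}` irreducible but the `3`-adic tower not onto (Elkies' `9`-deficient images; `ρ̄₃` onto ⇏ tower onto at `p = 3`) are outside
T1⁺'s scope as filed and remain with Σ⁺₂ verbatim.
References: [cite: Jetchev2008, Conj. 1.3 (p. 812)] [cite: WZhang2014, §3.8 and Conj. 3.2] [cite: BurungaleEtAl2026, Thm. 2]
[cite: McCallumLMS1991, §4 Cor. 4.5] [cite: GrossZagier1986, I.§7] [cite: BCDT2001, Thm. A]. presearch (D-0021): `lean search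
'RKC3Divisibility|MinftyGe'` → the O5/O6 statement file and SOED's consumers (`…WildKolyvaginUpperAtThreeOfMinftyGe`, `…OfKo`,
RHP `…KolyvaginRoadOfRefinedKolyvagin` — the INdivisibility half); no TQS/TQMP consumer of T1⁺ before this file; corpus/galaxy as in the
sibling `…SigmaMethodBarrier` (nothing at an additive `p`). Pure composition of tree theorems; axioms standard.
-/

-- D-0017: single-problem summit, so `Summit.BirchSwinnertonDyer.BirchSwinnertonDyer.…` repeats a namespace BY DESIGN.
set_option linter.dupNamespace false
set_option autoImplicit false

noncomputable section

open scoped Classical NumberField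

open WeierstrassCurve IsDedekindDomain NumberField Literature Literature.NumberTheory.EllipticCurves
  Literature.NumberTheory.EllipticCurves.ModularForms
  Literature.NumberTheory.EllipticCurves.Rank1Residual
  Literature.NumberTheory.EllipticCurves.Rank1Residual.Typed
  Summit.BirchSwinnertonDyer.Rank1Residual
  Summit.BirchSwinnertonDyer.Rank1Residual.Additive
  Summit.BirchSwinnertonDyer.Rank1Residual.X11b
  Summit.BirchSwinnertonDyer.Rank1Residual.X11b.Three
  Summit.BirchSwinnertonDyer.BirchSwinnertonDyer.Theorems
  Summit.BirchSwinnertonDyer.BirchSwinnertonDyer.Theorems.WildKolyvaginUpperAtThreeOfMinftyGe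
  Summit.BirchSwinnertonDyer.BirchSwinnertonDyer.Theorems.CumulativeHeegnerInclusionAtThreeCornutVatsalFamily

namespace Summit.BirchSwinnertonDyer.BirchSwinnertonDyer.Theorems.TprimeHeegnerUpperOfManinUnit

/-! ## Σ on the `3`-adic-tower rows from T1⁺ -/

/-- **Σ ON THE TOWER-ONTO ROWS ⟸ T1⁺ `RKC3Divisibility` + `exists_isNewformOf`.** The registered research stub Σ =
`stub_sigmaIrreducibleOptimalRows` (crux 23738, line `rows_of_manin_unit` v2) — its binders and conclusion VERBATIM, with ONE extra row
binder `AdditiveThree.TowerSurjThree W` (`ρ_{E,3^n}` onto for every `n ≥ 1`) — follows from the cell's typed conjecture item T1⁺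
`AdditiveThree.RKC3Divisibility` (the divisibility half `M_∞ ≥ ord₃ ∏_q c_q(E)` of the refined Kolyvagin conjecture at an additive `3`,
class currency) and the skeleton's print input `exists_isNewformOf`. Proof: `9 ∣ N_E` from `Addv W 3`; `d_K ≠ −3` from the Heegner
hypothesis at `3 ∣ N_E`; `d_K ≠ −4` and `d_K < −4` from `d_K` odd; `ord_{s=1} L(E/K,s) = r_an(E) + r_an(E^{(d_K)}) = 1` (orders of the
entire factors add); the orientation from the datum; T1⁺
gives `MinftyGe W K Dt H.β ι (ord₃ ∏ c_ℓ)`; SOED's `pDiv_of_minftyGe` (McCallum Cor. 4.5, `ρ̄₃` onto from the tower at `n = 1`) turns it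
into `3^{s'} ∣ P(n)` in `E(K[n])`. CONDITIONAL on T1⁺ (OPEN — `@[conjecture]`; equivalent pair by pair to BSD₃(E/K) in Gross–Zagier
form given Kolyvagin's structure theorem) and on `exists_isNewformOf` (print). Closes nothing by name; it KEYS the residual Σ⁺₂ of the
line on the tower-onto rows to an existing conjecture declaration. [cite: Jetchev2008, Conj. 1.3 (p. 812)] [cite: WZhang2014, §3.8]
[cite: McCallumLMS1991, §4 Cor. 4.5] -/
theorem sigma_towerRows_of_rkc3Divisibility (hRKC : AdditiveThree.RKC3Divisibility) (hnf : exists_isNewformOf) :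
    ∀ (W : WeierstrassCurve ℚ) [W.IsElliptic] [W.IsGloballyMinimal] [NeZero (W.conductorNorm ℤ)]
      (K : Type) [Field K] [NumberField K] (Dt : ModularParametrizationData W (W.conductorNorm ℤ))
      (H : HeegnerDatum (W.conductorNorm ℤ) (NumberField.discr K)) (ι : K →+* ℂ) (P : (W.baseChange K).toAffine.Point),
      ¬ W.HasCM → Addv W 3 → SubTprime W 3 → W.HasIrreducibleModPGaloisRep 3 → AdditiveThree.TowerSurjThree W →
      W.analyticRank = 1 →
      ¬ (3 : ℤ) ∣ Dt.c → IsImaginaryQuadratic K → SatisfiesHeegnerHypothesis (W.conductorNorm ℤ) K →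
      (W.quadraticTwist (NumberField.discr K : ℚ)).entireLFunction 1 ≠ 0 →
      WeierstrassCurve.Affine.Point.map ι.toRatAlgHom P = heegnerPointComplex Dt H → ¬ IsOfFinAddOrder P →
      Odd (NumberField.discr K) →
      ∀ (s' : ℕ), s' ≤ padicValNat 3 W.tamagawaProduct →
      ∀ (n : ℕ) (d : KolyvaginHeegnerData Dt H.β ι n), Squarefree n →
      (∀ ℓ ∈ n.primeFactors, Zhang2014.IsKolyvaginPrime (W.conductorNorm ℤ) W K 3 ℓ ∧
        s' ≤ Zhang2014.kolyvaginIndex W 3 ℓ) → Koly.PDiv d 3 s' := by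
  intro W _ _ _ K _ _ Dt H ι P _ hadd _ _ hTower hr hc hK hHN hL _ _ hodd s' hs' n d hn hkol
  haveI : Fact (Nat.Prime 3) := ⟨Nat.prime_three⟩
  -- `9 ∣ N_E` (additive at `3`)
  have h9 : 9 ∣ W.conductorNorm ℤ := by
    have h := sq_dvd_conductorNorm_of_addv_three W hadd
    norm_num at h
    exact h
  -- `d_K ≠ -3`: `3 ∣ N_E` and `(N_E, d_K) = 1` (Heegner hypothesis)
  have h3 : NumberField.discr K ≠ -3 := by
    intro hdisc
    have hcop := Literature.SatisfiesHeegnerHypothesis.coprime_discr hK.1 hHN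
    rw [hdisc] at hcop
    have h3N : 3 ∣ W.conductorNorm ℤ := dvd_trans (by norm_num) h9
    exact absurd (Nat.Coprime.coprime_dvd_left h3N hcop) (by decide)
  -- `d_K ≠ -4`, `d_K < -4` (odd discriminant, orientation from the datum)
  have h4 : NumberField.discr K ≠ -4 := by
    rintro hdisc
    rw [hdisc] at hodd
    exact absurd hodd (by decide)
  have hD : NumberField.discr K < -4 := discr_lt_neg_four_of_odd hK hodd h3 d.dvd_sq_sub
  -- `ord_{s=1} L(E/K, s) = r_an(E) + r_an(E^{(d_K)}) = 1 + 0` (continuation from `exists_isNewformOf`; the same four lines are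
  -- the tree's `CMSupply.analyticRankEK_eq_one_of_rankOne`, whose module sits in the CMKolyvaginAtInertTwo cone — not imported here)
  have hrk : analyticRankEK W K = 1 := by
    have hE := hasEntireLFunction_rat_of_exists_isNewformOf hnf
    have hd : (NumberField.discr K : ℚ) ≠ 0 := by exact_mod_cast NumberField.discr_ne_zero K
    haveI := W.isElliptic_quadraticTwist hd
    rw [analyticRankEK_eq_add_of_hasEntireLFunction W K (hE W) (hE _), hr,
      analyticRank_eq_zero_of_entireLFunction_one_ne_zero _ hL]
  -- T1⁺ at the frame: `M_∞ ≥ ord₃ ∏ c_ℓ` in class currency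
  have hMin : AdditiveThree.MinftyGe W K Dt H.β ι (padicValNat 3 W.tamagawaProduct) :=
    hRKC W h9 hTower K hK h3 h4 hHN hrk Dt H.β ι d.dvd_sq_sub hc
  -- class ⟹ point currency (McCallum Cor. 4.5), `ρ̄₃` onto from the tower at `n = 1`
  have hsurj : W.HasSurjectiveModNGaloisRep 3 := by simpa using hTower 1 le_rfl
  exact pDiv_of_minftyGe W K hK hHN hD hsurj Dt H.β ι hMin hs' d hn hkol

/-- **The pen's v3 residual stub Σ⁺₂ (`stub_sigmaIncrementTwoSplit`, staged b1b621d03ef2796d) ON THE TOWER-ONTO ROWS ⟸ T1⁺.** Same as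
`sigma_towerRows_of_rkc3Divisibility`, stated for the v3 text VERBATIM — Σ's binders + `SatisfiesHeegnerHypothesis 2 K` + the depth guard
«every prime `q ∣ N_E` has `ord₃ c_q(E/ℚ_q) < s′`» — with the ONE extra row binder `AdditiveThree.TowerSurjThree W`; the two v3 hypotheses are
simply not used (T1⁺ pays every depth `s′ ≤ ord₃ ∏ c_ℓ`). CONDITIONAL on T1⁺ (OPEN, `@[conjecture]`) and `exists_isNewformOf` (print);
closes nothing by name (one binder more than the stub). [cite: Jetchev2008, Conj. 1.3 (p. 812)] [cite: WZhang2014, §3.8] -/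
theorem sigmaIncrementTwoSplit_towerRows_of_rkc3Divisibility (hRKC : AdditiveThree.RKC3Divisibility) (hnf : exists_isNewformOf) :
    ∀ (W : WeierstrassCurve ℚ) [W.IsElliptic] [W.IsGloballyMinimal] [NeZero (W.conductorNorm ℤ)]
      (K : Type) [Field K] [NumberField K] (Dt : ModularParametrizationData W (W.conductorNorm ℤ))
      (H : HeegnerDatum (W.conductorNorm ℤ) (NumberField.discr K)) (ι : K →+* ℂ) (P : (W.baseChange K).toAffine.Point),
      ¬ W.HasCM → Addv W 3 → SubTprime W 3 → W.HasIrreducibleModPGaloisRep 3 → AdditiveThree.TowerSurjThree W →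
      W.analyticRank = 1 →
      ¬ (3 : ℤ) ∣ Dt.c → IsImaginaryQuadratic K → SatisfiesHeegnerHypothesis (W.conductorNorm ℤ) K →
      SatisfiesHeegnerHypothesis 2 K →
      (W.quadraticTwist (NumberField.discr K : ℚ)).entireLFunction 1 ≠ 0 →
      WeierstrassCurve.Affine.Point.map ι.toRatAlgHom P = heegnerPointComplex Dt H → ¬ IsOfFinAddOrder P →
      Odd (NumberField.discr K) →
      ∀ (s' : ℕ), (∀ (q : ℕ) [Fact q.Prime], q ∣ W.conductorNorm ℤ →
          padicValNat 3 ((W.baseChange ℚ_[q]).localTamagawaNumber ℤ_[q]) < s') →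
      s' ≤ padicValNat 3 W.tamagawaProduct →
      ∀ (n : ℕ) (d : KolyvaginHeegnerData Dt H.β ι n), Squarefree n →
      (∀ ℓ ∈ n.primeFactors, Zhang2014.IsKolyvaginPrime (W.conductorNorm ℤ) W K 3 ℓ ∧
        s' ≤ Zhang2014.kolyvaginIndex W 3 ℓ) → Koly.PDiv d 3 s' :=
  fun W _ _ _ K _ _ Dt H ι P hCM hadd hT hirr hTower hr hc hK hHN _ hL hP hnt hodd s' _ hs' n d hn hkol ↦
    sigma_towerRows_of_rkc3Divisibility hRKC hnf W K Dt H ι P hCM hadd hT hirr hTower hr hc hK hHN hL hP hnt hodd s' hs' n d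
      hn hkol

end Summit.BirchSwinnertonDyer.BirchSwinnertonDyer.Theorems.TprimeHeegnerUpperOfManinUnit

end
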